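import Literature.NumberTheory.EllipticCurves.WeilPairingLevelCompatProofs
import Literature.NumberTheory.EllipticCurves.HeegnerModuleIndex
import Literature.NumberTheory.EllipticCurves.GaloisActionProofs
import Literature.NumberTheory.GaloisRepresentations.LocalGlobalCohomologyDualityProofs
import HarnessLib

/-!
# The compatible tower of Weil pairings on `E[p^k]` in the `μ_{p^k}`-valued additive currency (proofs)

`Proofs` file (theorems only; no definition, no named fact, no instance) in topic `NumberTheory/EllipticCurves`.

The tree CONSTRUCTS the Weil pairings `e_{p^k}` of an elliptic curve (`WeierstrassCurve.weilPairingFun`,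
`WeilPairingProofs.lean`, Silverman *AEC* III.8.1 (a)–(d)) and proves their compatibility along `[p]`
(`WeilPairingLevelCompatProofs.lean`, III.8.1 (e): `e_{p^k}(pS, pT) = e_{p^{k+1}}(S, T)^p`), packaged as
`WeierstrassCurve.exists_weilPairing_tower` — a family of `F̄`-valued functions on `E(F̄)` under torsion
hypotheses.  The consumers of the cell `pub/bsd-print-x9` (Howard 2004, H.4: the duality data
`ZpExtension.eisensteinDualityDatum … (conjPairing e θ log) …` of the Eisenstein levels `E[p^k] ⊗ A_{m,k}(ψ)`, and
their `e_red` compatibility `eisensteinDualityForm_reduce`) need the SAME pairings in the additive currency of the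
tree's discrete Galois modules: biadditive maps

  `e_k : E[p^k] →+ E[p^k] →+ μ_{p^k}`  (`E[p^k] = geomTorsion W ((p : ℤ)^k)`, `μ_{p^k} = MuCarrier F (p^k)`),

indexed EXACTLY as the levels `torsionGaloisModule ((p : ℤ)^k)` / `geomTorsionReduce p k` of the Eisenstein tower.
This file supplies them, with every property of III.8.1 transported, PLUS the exhaustion of characters
(`E[p^k] → Hom(E[p^k], μ_{p^k})` is onto: injective by non-degeneracy, and both sides have `p^{2k}` elements,
Silverman III.6.4(b)) and the compatibility along `geomTorsionReduce` (`P ↦ pP`):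

* **`WeierstrassCurve.exists_weilPairingHom_tower`** — ONE family `e_k`, each level alternating
  (`e_k(T,T) = 0`, hence skew `e_k(T,S) = -e_k(S,T)`), left- and right-non-degenerate, `Γ_F`-equivariant
  (`e_k(σS, σT) = σ · e_k(S,T)`, stated through `torsionGaloisModule`/`DiscreteGaloisModule.mu`), exhausting
  `Hom(E[p^k], μ_{p^k})`, and COMPATIBLE: `e_k(pS, pT) = e_{k+1}(S,T)^p` (on underlying units, `muVal`).

GENERIC over the base field `F` (any `W` elliptic over `F`, `p ≠ 0` in `F`; no complex conjugation, no `ℚ̄ → K̄`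
transport).  The cell's `K̄`-side family WITH the complex-conjugation sign `e(τa, τb) = -e(a,b)` for `E/ℚ` base-changed
to `K` is the sibling `WeilConjugatePairingTowerProofs` (x9-p1-w2); the compatible discrete logarithms are
`CompatibleRootsOfUnityLogProofs` (`exists_compatible_muLog`, same `muVal`-currency for the compatibility clause).

References: [SilvermanAEC2009] J. H. Silverman, *The Arithmetic of Elliptic Curves*, 2nd ed. (2009), Prop. III.8.1
(a)–(e), Cor. III.6.4(b); [Howard2004HeegnerKolyvagin] B. Howard, Compositio Math. 140 (2004), §1.3 H.4, §1.6 (the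
tower `T^{(k)}` with its induced pairings); [GrossLMS1991] B. Gross, *Kolyvagin's work on modular elliptic curves*
(1991), §7 (7.2) (the cup product on `H¹(K, E[p])` from the Weil pairing).
BSD is not proved by any of this.
-/

noncomputable section

open Field
open scoped Classical

universe u

/-! ## The tower `e_k : E[p^k] →+ E[p^k] →+ μ_{p^k}` -/

namespace WeierstrassCurve

open Literature.NumberTheory.EllipticCurves Literature.NumberTheory.GaloisRepresentations
open Literature.NumberTheory.GaloisRepresentations.DiscreteGaloisModule

variable {F : Type u} [Field F] (W : WeierstrassCurve F) [W.IsElliptic] {p : ℕ} [hp : Fact p.Prime]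

/-- **The compatible tower of Weil pairings in additive `μ_{p^k}`-valued form.** For an elliptic curve `E = W` over a
field `F` with `p ≠ 0` in `F` there is ONE family of biadditive pairings
`e_k : E[p^k] →+ E[p^k] →+ μ_{p^k}(F̄)` (`k ≥ 0`, `E[p^k] = geomTorsion W ((p : ℤ)^k)`) which at every level is
alternating, skew-symmetric, left- and right-non-degenerate, `Γ_F`-equivariant and exhausts `Hom(E[p^k], μ_{p^k})`,
and which is COMPATIBLE along multiplication by `p`: `e_k(pS, pT) = e_{k+1}(S, T)^p` for `S, T ∈ E[p^{k+1}]`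
(Silverman, *AEC*, Prop. III.8.1 (a)–(e) — the tree's constructed `weilPairingFun`, `exists_weilPairing_tower` —
and Cor. III.6.4(b) for the exhaustion count `#E[p^k] = #Hom(E[p^k], μ_{p^k}) = p^{2k}`).
[cite: SilvermanAEC2009, Prop. III.8.1 (a)–(e) and Cor. III.6.4(b)] -/
theorem exists_weilPairingHom_tower (hpF : (p : F) ≠ 0) :
    ∃ e : (k : ℕ) → geomTorsion W ((p : ℤ) ^ k) →+ geomTorsion W ((p : ℤ) ^ k) →+ MuCarrier F (p ^ k),
      (∀ (k : ℕ) (T : geomTorsion W ((p : ℤ) ^ k)), e k T T = 0) ∧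
      (∀ (k : ℕ) (S T : geomTorsion W ((p : ℤ) ^ k)), e k T S = -e k S T) ∧
      (∀ (k : ℕ) (S : geomTorsion W ((p : ℤ) ^ k)), (∀ T, e k S T = 0) → S = 0) ∧
      (∀ (k : ℕ) (T : geomTorsion W ((p : ℤ) ^ k)), (∀ S, e k S T = 0) → T = 0) ∧
      (∀ (k : ℕ) (σ : absoluteGaloisGroup F) (S T : geomTorsion W ((p : ℤ) ^ k)),
        e k (W.torsionGaloisModule ((p : ℤ) ^ k) σ S) (W.torsionGaloisModule ((p : ℤ) ^ k) σ T) =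
          mu F (p ^ k) σ (e k S T)) ∧
      (∀ (k : ℕ) (ψ : geomTorsion W ((p : ℤ) ^ k) →+ MuCarrier F (p ^ k)),
        ∃ S : geomTorsion W ((p : ℤ) ^ k), ∀ T, e k S T = ψ T) ∧
      (∀ (k : ℕ) (S T : geomTorsion W ((p : ℤ) ^ (k + 1))),
        muVal F (p ^ k) (e k (W.geomTorsionReduce p k S) (W.geomTorsionReduce p k T)) =
          muVal F (p ^ (k + 1)) (e (k + 1) S T) ^ p) := by
  have hpp := hp.out
  haveI hnz : ∀ k, NeZero (p ^ k) := fun k ↦ ⟨pow_ne_zero k hpp.ne_zero⟩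
  have hpL : (p : AlgebraicClosure F) ≠ 0 := fun h ↦ hpF <| by
    apply (algebraMap F (AlgebraicClosure F)).injective
    rw [map_natCast, map_zero, h]
  obtain ⟨e, hpow, hadd₁, hadd₂, hself, hnd, hgal, hsucc⟩ := exists_weilPairing_tower (W := W) hpF
  -- members of `E[p^k]` satisfy the torsion hypothesis in the `ℕ`-cast form of the tower theorem
  have hmem : ∀ (k : ℕ) (S : geomTorsion W ((p : ℤ) ^ k)), ((p ^ k : ℕ) : ℤ) • (S : geomPoints W) = 0 :=
    fun k S ↦ by rw [Nat.cast_pow]; exact (mem_geomTorsion_iff W ((p : ℤ) ^ k) (S : geomPoints W)).1 S.2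
  -- the additive packaging
  let val : ∀ k, geomTorsion W ((p : ℤ) ^ k) → geomTorsion W ((p : ℤ) ^ k) → MuCarrier F (p ^ k) :=
    fun k S T ↦ MuCarrier.ofRootsOfUnity (rootsOfUnity.mkOfPowEq (e k S T) (hpow k S T (hmem k S) (hmem k T)))
  have hval : ∀ k (S T : geomTorsion W ((p : ℤ) ^ k)),
      ((muVal F (p ^ k) (val k S T) : (AlgebraicClosure F)ˣ) : AlgebraicClosure F) = e k S T := fun _ _ _ ↦ rfl
  have hinj : ∀ k (x y : MuCarrier F (p ^ k)),
      ((muVal F (p ^ k) x : (AlgebraicClosure F)ˣ) : AlgebraicClosure F) = (muVal F (p ^ k) y : AlgebraicClosure F) →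
        x = y := fun k x y h ↦ muVal_injective F (p ^ k) (Units.ext h)
  let E : ∀ k, geomTorsion W ((p : ℤ) ^ k) →+ geomTorsion W ((p : ℤ) ^ k) →+ MuCarrier F (p ^ k) := fun k ↦
    AddMonoidHom.mk' (fun S ↦ AddMonoidHom.mk' (fun T ↦ val k S T) fun T₁ T₂ ↦ hinj k _ _ (by
        rw [hval, muVal_add, Units.val_mul, hval, hval]
        exact hadd₂ k S T₁ T₂ (hmem k S) (hmem k T₁) (hmem k T₂)))
      fun S₁ S₂ ↦ by
        ext T
        refine hinj k _ _ ?_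
        rw [AddMonoidHom.mk'_apply, AddMonoidHom.add_apply, AddMonoidHom.mk'_apply, AddMonoidHom.mk'_apply,
          hval, muVal_add, Units.val_mul, hval, hval]
        exact hadd₁ k S₁ S₂ T (hmem k S₁) (hmem k S₂) (hmem k T)
  have hE : ∀ k (S T : geomTorsion W ((p : ℤ) ^ k)),
      ((muVal F (p ^ k) (E k S T) : (AlgebraicClosure F)ˣ) : AlgebraicClosure F) = e k S T := fun _ _ _ ↦ rfl
  -- alternating
  have halt : ∀ (k : ℕ) (T : geomTorsion W ((p : ℤ) ^ k)), E k T T = 0 := fun k T ↦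
    hinj k _ _ (by rw [hE, muVal_zero, Units.val_one]; exact hself k T (hmem k T))
  -- skew
  have hskew : ∀ (k : ℕ) (S T : geomTorsion W ((p : ℤ) ^ k)), E k T S = -E k S T := fun k S T ↦ by
    have h := halt k (S + T)
    simp only [map_add, AddMonoidHom.add_apply, halt, zero_add, add_zero] at h
    exact eq_neg_of_add_eq_zero_left h
  -- right non-degeneracy
  have hndR : ∀ (k : ℕ) (T : geomTorsion W ((p : ℤ) ^ k)), (∀ S, E k S T = 0) → T = 0 := fun k T h ↦ by
    have h1 : ∀ S : geomPoints W, ((p ^ k : ℕ) : ℤ) • S = 0 → e k S T = 1 := fun S hS ↦ by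
      have hS' : S ∈ geomTorsion W ((p : ℤ) ^ k) := by
        rw [mem_geomTorsion_iff, ← Nat.cast_pow]; exact hS
      have := congrArg (fun x ↦ ((muVal F (p ^ k) x : (AlgebraicClosure F)ˣ) : AlgebraicClosure F)) (h ⟨S, hS'⟩)
      simpa only [hE, muVal_zero, Units.val_one] using this
    exact Subtype.ext (hnd k T (hmem k T) h1)
  -- left non-degeneracy
  have hndL : ∀ (k : ℕ) (S : geomTorsion W ((p : ℤ) ^ k)), (∀ T, E k S T = 0) → S = 0 := fun k S h ↦
    hndR k S fun T ↦ by rw [hskew, h T, neg_zero]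
  -- equivariance
  have hgalE : ∀ (k : ℕ) (σ : absoluteGaloisGroup F) (S T : geomTorsion W ((p : ℤ) ^ k)),
      E k (W.torsionGaloisModule ((p : ℤ) ^ k) σ S) (W.torsionGaloisModule ((p : ℤ) ^ k) σ T) =
        mu F (p ^ k) σ (E k S T) := fun k σ S T ↦ hinj k _ _ (by
    rw [hE, muVal_apply, Units.coe_smul, hE, torsionGaloisModule_apply_apply, torsionGaloisModule_apply_apply,
      AddSubgroup.torsionBy.coe_smul, AddSubgroup.torsionBy.coe_smul]
    exact hgal k σ S T (hmem k S) (hmem k T))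
  -- exhaustion of characters: `S ↦ e_k(S, ·)` is injective between sets of the same finite size
  have hex : ∀ (k : ℕ) (ψ : geomTorsion W ((p : ℤ) ^ k) →+ MuCarrier F (p ^ k)),
      ∃ S : geomTorsion W ((p : ℤ) ^ k), ∀ T, E k S T = ψ T := by
    intro k ψ
    have hpk : ((p : ℤ) ^ k) ≠ 0 := pow_ne_zero k (by exact_mod_cast hpp.ne_zero)
    haveI hfin : Finite (geomTorsion W ((p : ℤ) ^ k)) := finite_torsionPoints_holds W (AlgebraicClosure F) hpk
    haveI : NeZero ((p ^ k : ℕ) : AlgebraicClosure F) := ⟨by rw [Nat.cast_pow]; exact pow_ne_zero k hpL⟩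
    haveI : Finite (MuCarrier F (p ^ k)) :=
      Finite.of_equiv (rootsOfUnity (p ^ k) (AlgebraicClosure F)) (MuCarrier.toAdditive.symm.toEquiv)
    haveI : Finite (geomTorsion W ((p : ℤ) ^ k) →+ MuCarrier F (p ^ k)) :=
      Finite.of_injective _ DFunLike.coe_injective
    -- `μ_{p^k}(F̄) ≃ ℤ/p^k`
    haveI : IsAddCyclic (MuCarrier F (p ^ k)) :=
      inferInstanceAs (IsAddCyclic (Additive (rootsOfUnity (p ^ k) (AlgebraicClosure F))))
    have hcardμ : Nat.card (MuCarrier F (p ^ k)) = p ^ k :=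
      HasEnoughRootsOfUnity.natCard_rootsOfUnity (AlgebraicClosure F) (p ^ k)
    let ι : MuCarrier F (p ^ k) ≃+ ZMod (p ^ k) :=
      (zmodAddCyclicAddEquiv (G := MuCarrier F (p ^ k)) inferInstance).symm.trans
        (ZMod.ringEquivCongr hcardμ).toAddEquiv
    -- counting
    have hkill : ∀ a : geomTorsion W ((p : ℤ) ^ k), (p ^ k) • a = 0 := fun a ↦ by
      apply Subtype.ext
      rw [AddSubgroup.coe_nsmul, AddSubgroup.coe_zero, ← natCast_zsmul, Nat.cast_pow]
      exact (mem_geomTorsion_iff W ((p : ℤ) ^ k) (a : geomPoints W)).1 a.2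
    have hHom : Nat.card (geomTorsion W ((p : ℤ) ^ k) →+ ZMod (p ^ k)) = Nat.card (geomTorsion W ((p : ℤ) ^ k)) :=
      Nat.card_addMonoidHom_zmod hkill
    have hle : Nat.card (geomTorsion W ((p : ℤ) ^ k) →+ MuCarrier F (p ^ k)) ≤
        Nat.card (geomTorsion W ((p : ℤ) ^ k)) := by
      rw [← hHom]
      haveI : Finite (geomTorsion W ((p : ℤ) ^ k) →+ ZMod (p ^ k)) := Finite.of_injective _ DFunLike.coe_injective
      refine Nat.card_le_card_of_injective (fun f ↦ (ι : MuCarrier F (p ^ k) →+ ZMod (p ^ k)).comp f)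
        fun f g hfg ↦ ?_
      ext T
      exact ι.injective (DFunLike.congr_fun hfg T)
    have hinjE : Function.Injective (fun S : geomTorsion W ((p : ℤ) ^ k) ↦ E k S) := fun S₁ S₂ h12 ↦ by
      rw [← sub_eq_zero]
      refine hndL k _ fun T ↦ ?_
      rw [map_sub, AddMonoidHom.sub_apply, sub_eq_zero]
      exact DFunLike.congr_fun h12 T
    obtain ⟨S, hS⟩ := (hinjE.bijective_of_nat_card_le hle).2 ψ
    exact ⟨S, fun T ↦ DFunLike.congr_fun hS T⟩
  -- compatibility along `[p]`
  have hred : ∀ (k : ℕ) (S T : geomTorsion W ((p : ℤ) ^ (k + 1))),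
      muVal F (p ^ k) (E k (W.geomTorsionReduce p k S) (W.geomTorsionReduce p k T)) =
        muVal F (p ^ (k + 1)) (E (k + 1) S T) ^ p := fun k S T ↦ Units.ext (by
    rw [hE, Units.val_pow_eq_pow_val, hE, coe_geomTorsionReduce, coe_geomTorsionReduce]
    exact hsucc k S T (hmem (k + 1) S) (hmem (k + 1) T))
  exact ⟨E, halt, hskew, hndL, hndR, hgalE, hex, hred⟩

end WeierstrassCurve


end
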